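import Summits.QuantumFields.BalabanUV.Beta.RootedJetReflection

/-!
# `BalabanUV.Beta.RootedJetLinear` — ω-LINEARITY AND `Tau`-CENTRALITY OF THE ROOTED AVERAGED JET ON THE LEFT CHART WITH
# GENERAL BACKGROUND (`QjetLAt`), hence of node 12b's `QjetAt` and `T2At`
# (β sub-cell, row D1 letter chain HR-W-LET, an1's list «NOT in AN1-28B (next)» item 1; an3 gen 33, an1 first refusal)

HONEST FRAMING (cell charter, verbatim): «discharging BetaPertH makes Bałaban's UV stability UNCONDITIONAL — a real
constructive-QFT result; it is NOT the continuum limit and NOT the Clay problem.»  HONEST DEPENDENCY (verbatim): «continuum YM on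
T⁴ ⇐ BetaPertH ∧ nine spine estimates (0/9 proved); BetaPertH ⇐ (D1) ∧ (D4) ∧ CAP+tail; G-an2-4 gates asym, D1 and NE2/3/4.»
DERIVED cell leaf: [folklore] ring algebra — node 12's naturality proofs of `Qjet_mul_central`∕`Qjet_add` (ρ = 0, background
`Ebg B B′`) transported verbatim to the ROOTED jet (`PhiGAt`, node 12b's `map_PhiGAt`) on the general-background chart of
`RootedJetReflection` (`GfL`∕`GbL`∕`PhiLAt`∕`QjetLAt`).  No statement of Bałaban's papers is typed here, no `[cite:]` tag, no `Prop` is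
minted, no binder of the β-function wall (`hW`/`hR`/`D1Tel`/`D1Rep`, (D1), `BetaPertH`) is instantiated or discharged.  NOT summit progress.

## What this module proves

* §1 CENTRALITY: `QjetLAt ρ (s·ω) E Ē = s · QjetLAt ρ ω E Ē` for every CENTRAL `s ∈ Tau 𝔸` (`QjetLAt_mul_central`; instances
  `τ₁`, `τ₂`, `τ12`, scalars `r : 𝕜`), by naturality of `PhiGAt`, `logT`, `invT` along node 12's `scaleDual s`.
* §2 ADDITIVITY: `QjetLAt ρ (ω₁ + ω₂) E Ē = QjetLAt ρ ω₁ E Ē + QjetLAt ρ ω₂ E Ē` (`QjetLAt_add`; `_zero`, `_neg`, `_sub`), by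
  naturality along the three maps `Rho[ρ′] → Rho` (kill `ρ′`, kill `ρ`, merge `ρ′ = ρ`) on the DOUBLED letters `GfL2`∕`GbL2`.
* §3 The same for node 12b's `QjetAt ρ ω B B′` (the instance `E = Ebg B B′`, `Ē = Ebi B B′`, bridge `QjetAt_eq_QjetLAt` `rfl`) and for the
  symmetrised response `T2At ρ` (`QjetAt_add_ω`, `QjetAt_mul_central`, `T2At_add_ω`, `T2At_neg_ω`, …).

## What is NOT here
No reflection, no `Ad`-expansion, no table.  These are the linear-algebra prerequisites for expanding the reflected fluctuation
letter `omegaR` of `RootedJetReflection` by components.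
-/

namespace Summit.QuantumFields.BalabanUV.Beta.RootedJetLinear

open Literature.MathematicalPhysics.QuantumFieldTheory.Balaban1983to89
open Literature.MathematicalPhysics.QuantumFieldTheory.Balaban1983to89.Beta
open AffineAveraging (Form1)
open AveragingThirdJet (Tau Rho dmk fst_dmk snd_dmk dfst_mul dsnd_mul mapDual fst_mapDual snd_mapDual scaleDual fst_scaleDual
  snd_scaleDual mergeDual fst_mergeDual snd_mergeDual Ebg Ebi logT invT map_logT map_invT)
open AveragingThirdJet.Tau (τ₁ τ₂ τ12 c11 c11_add c11_neg c11_smul τ₁_comm τ₂_comm τ12_comm)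
open AveragingMixedJetTables (PhiGAt map_PhiGAt QjetAt T2At)
open Summit.QuantumFields.BalabanUV.Beta.RootedJetReflection (GfL GbL PhiLAt QjetLAt fst_GfL snd_GfL fst_GbL snd_GbL
  QjetAt_eq_QjetLAt)

variable {𝕜 : Type*} [Field 𝕜] {d : ℕ} {𝔸 : Type*} [Ring 𝔸] [Algebra 𝕜 𝔸]

/-! ## §1 Centrality -/

/-- [folklore] HOMOGENEITY of the rooted jet on the general-background chart under CENTRAL elements of `Tau 𝔸`. -/
theorem QjetLAt_mul_central (s : Tau 𝔸) (hs : ∀ t, s * t = t * s) (ρ : Fin d → ℤ) (ω E Eb : Form1 d (Tau 𝔸)) (L : ℕ)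
    (μ : Fin d) (y : Fin d → ℤ) :
    QjetLAt 𝕜 ρ (fun κ x => s * ω κ x) E Eb L μ y = s * QjetLAt 𝕜 ρ ω E Eb L μ y := by
  have hG1 : ∀ κ x, scaleDual (𝕜 := 𝕜) s hs (GfL ω E κ x) = GfL (fun κ x => s * ω κ x) E κ x :=
    fun κ x => TrivSqZeroExt.ext (by simp) (by simp [mul_assoc])
  have hG0 : ∀ κ x, scaleDual (𝕜 := 𝕜) s hs (GfL 0 E κ x) = GfL 0 E κ x :=
    fun κ x => TrivSqZeroExt.ext (by simp) (by simp)
  have hGb1 : ∀ κ x, scaleDual (𝕜 := 𝕜) s hs (GbL ω Eb κ x) = GbL (fun κ x => s * ω κ x) Eb κ x :=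
    fun κ x => TrivSqZeroExt.ext (by simp)
      (by rw [snd_scaleDual, snd_GbL, snd_GbL, mul_neg, ← mul_assoc, hs, mul_assoc])
  have hGb0 : ∀ κ x, scaleDual (𝕜 := 𝕜) s hs (GbL 0 Eb κ x) = GbL 0 Eb κ x :=
    fun κ x => TrivSqZeroExt.ext (by simp) (by simp)
  unfold QjetLAt PhiLAt
  have key := congrArg TrivSqZeroExt.snd (map_logT (scaleDual (𝕜 := 𝕜) s hs)
    (PhiGAt 𝕜 ρ (GfL ω E) (GbL ω Eb) L μ y * invT (PhiGAt 𝕜 ρ (GfL 0 E) (GbL 0 Eb) L μ y)))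
  simp only [map_mul, map_invT, map_PhiGAt, hG1, hG0, hGb1, hGb0, snd_scaleDual] at key
  exact key.symm

/-- [folklore] … in particular for `τ₁`. -/
theorem QjetLAt_τ₁_mul (ρ : Fin d → ℤ) (ω E Eb : Form1 d (Tau 𝔸)) (L : ℕ) (μ : Fin d) (y : Fin d → ℤ) :
    QjetLAt 𝕜 ρ (fun κ x => τ₁ * ω κ x) E Eb L μ y = τ₁ * QjetLAt 𝕜 ρ ω E Eb L μ y :=
  QjetLAt_mul_central τ₁ τ₁_comm ρ ω E Eb L μ y

/-- [folklore] … for `τ₂`. -/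
theorem QjetLAt_τ₂_mul (ρ : Fin d → ℤ) (ω E Eb : Form1 d (Tau 𝔸)) (L : ℕ) (μ : Fin d) (y : Fin d → ℤ) :
    QjetLAt 𝕜 ρ (fun κ x => τ₂ * ω κ x) E Eb L μ y = τ₂ * QjetLAt 𝕜 ρ ω E Eb L μ y :=
  QjetLAt_mul_central τ₂ τ₂_comm ρ ω E Eb L μ y

/-- [folklore] … for `τ₁τ₂`. -/
theorem QjetLAt_τ12_mul (ρ : Fin d → ℤ) (ω E Eb : Form1 d (Tau 𝔸)) (L : ℕ) (μ : Fin d) (y : Fin d → ℤ) :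
    QjetLAt 𝕜 ρ (fun κ x => τ12 * ω κ x) E Eb L μ y = τ12 * QjetLAt 𝕜 ρ ω E Eb L μ y :=
  QjetLAt_mul_central τ12 τ12_comm ρ ω E Eb L μ y

/-- [folklore] `𝕜`-HOMOGENEITY of the rooted jet on the general-background chart. -/
theorem QjetLAt_smul (r : 𝕜) (ρ : Fin d → ℤ) (ω E Eb : Form1 d (Tau 𝔸)) (L : ℕ) (μ : Fin d) (y : Fin d → ℤ) :
    QjetLAt 𝕜 ρ (r • ω) E Eb L μ y = r • QjetLAt 𝕜 ρ ω E Eb L μ y := by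
  have h := QjetLAt_mul_central (𝕜 := 𝕜) (algebraMap 𝕜 (Tau 𝔸) r) (fun t => Algebra.commutes r t) ρ ω E Eb L μ y
  simp only [← Algebra.smul_def] at h
  exact h

/-! ## §2 Additivity -/

/-- [folklore] The doubled forward letter in `Rho 𝔸 [ρ′]`: `U_f = (1 + ρ ω̂₁ + ρ′ ω̂₂) E_f`. -/
def GfL2 (η₁ η₂ E : Form1 d (Tau 𝔸)) : Form1 d (DualNumber (Rho 𝔸)) :=
  fun κ x => dmk (GfL η₁ E κ x) (dmk (η₂ κ x * E κ x) 0)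

/-- [folklore] The doubled backward letter `Ē_f (1 − ρ ω̂₁ − ρ′ ω̂₂)`. -/
def GbL2 (η₁ η₂ Eb : Form1 d (Tau 𝔸)) : Form1 d (DualNumber (Rho 𝔸)) :=
  fun κ x => dmk (GbL η₁ Eb κ x) (dmk (-(Eb κ x * η₂ κ x)) 0)

section TwoLetters

variable (η₁ η₂ E Eb : Form1 d (Tau 𝔸)) (κ : Fin d) (x : Fin d → ℤ)

omit [Algebra 𝕜 𝔸] in
/-- [folklore] `ρ′`-free part of the doubled forward letter. -/
@[simp] theorem fst_GfL2 : (GfL2 η₁ η₂ E κ x).fst = GfL η₁ E κ x := rfl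
omit [Algebra 𝕜 𝔸] in
/-- [folklore] `ρ′`-part of the doubled forward letter. -/
@[simp] theorem snd_GfL2 : (GfL2 η₁ η₂ E κ x).snd = dmk (η₂ κ x * E κ x) 0 := rfl
omit [Algebra 𝕜 𝔸] in
/-- [folklore] `ρ′`-free part of the doubled backward letter. -/
@[simp] theorem fst_GbL2 : (GbL2 η₁ η₂ Eb κ x).fst = GbL η₁ Eb κ x := rfl
omit [Algebra 𝕜 𝔸] in
/-- [folklore] `ρ′`-part of the doubled backward letter. -/
@[simp] theorem snd_GbL2 : (GbL2 η₁ η₂ Eb κ x).snd = dmk (-(Eb κ x * η₂ κ x)) 0 := rfl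

end TwoLetters

set_option synthInstance.maxHeartbeats 200000 in
set_option maxHeartbeats 1600000 in
/-- [folklore] **ADDITIVITY of the rooted jet in the fluctuation**, for any background letter pair. -/
theorem QjetLAt_add (ρ : Fin d → ℤ) (ω₁ ω₂ E Eb : Form1 d (Tau 𝔸)) (L : ℕ) (μ : Fin d) (y : Fin d → ℤ) :
    QjetLAt 𝕜 ρ (ω₁ + ω₂) E Eb L μ y = QjetLAt 𝕜 ρ ω₁ E Eb L μ y + QjetLAt 𝕜 ρ ω₂ E Eb L μ y := by
  have h2 : ∀ κ x, mapDual (TrivSqZeroExt.fstHom 𝕜 (Tau 𝔸) (Tau 𝔸)) (GfL2 ω₁ ω₂ E κ x) = GfL ω₂ E κ x :=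
    fun κ x => TrivSqZeroExt.ext (by simp) (by simp)
  have h2z : ∀ κ x, mapDual (TrivSqZeroExt.fstHom 𝕜 (Tau 𝔸) (Tau 𝔸)) (GfL2 0 0 E κ x) = GfL 0 E κ x :=
    fun κ x => TrivSqZeroExt.ext (by simp) (by simp)
  have h2b : ∀ κ x, mapDual (TrivSqZeroExt.fstHom 𝕜 (Tau 𝔸) (Tau 𝔸)) (GbL2 ω₁ ω₂ Eb κ x) = GbL ω₂ Eb κ x :=
    fun κ x => TrivSqZeroExt.ext (by simp) (by simp)
  have h2bz : ∀ κ x, mapDual (TrivSqZeroExt.fstHom 𝕜 (Tau 𝔸) (Tau 𝔸)) (GbL2 0 0 Eb κ x) = GbL 0 Eb κ x :=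
    fun κ x => TrivSqZeroExt.ext (by simp) (by simp)
  have h3 : ∀ κ x, mergeDual (𝕜 := 𝕜) (GfL2 ω₁ ω₂ E κ x) = GfL (ω₁ + ω₂) E κ x :=
    fun κ x => TrivSqZeroExt.ext (by simp) (by simp [add_mul])
  have h3z : ∀ κ x, mergeDual (𝕜 := 𝕜) (GfL2 0 0 E κ x) = GfL 0 E κ x :=
    fun κ x => TrivSqZeroExt.ext (by simp) (by simp)
  have h3b : ∀ κ x, mergeDual (𝕜 := 𝕜) (GbL2 ω₁ ω₂ Eb κ x) = GbL (ω₁ + ω₂) Eb κ x :=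
    fun κ x => TrivSqZeroExt.ext (by simp) (by
      rw [snd_mergeDual, fst_GbL2, snd_GbL2, snd_GbL, fst_dmk, snd_GbL, Pi.add_apply, Pi.add_apply, mul_add,
        neg_add])
  have h3bz : ∀ κ x, mergeDual (𝕜 := 𝕜) (GbL2 0 0 Eb κ x) = GbL 0 Eb κ x :=
    fun κ x => TrivSqZeroExt.ext (by simp) (by simp)
  unfold QjetLAt PhiLAt
  have k1 := congrArg TrivSqZeroExt.snd (map_logT (TrivSqZeroExt.fstHom 𝕜 (Rho 𝔸) (Rho 𝔸))
    (PhiGAt 𝕜 ρ (GfL2 ω₁ ω₂ E) (GbL2 ω₁ ω₂ Eb) L μ y * invT (PhiGAt 𝕜 ρ (GfL2 0 0 E) (GbL2 0 0 Eb) L μ y)))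
  simp only [map_mul, map_invT, map_PhiGAt, TrivSqZeroExt.fstHom_apply, fst_GfL2, fst_GbL2] at k1
  have k2 := congrArg TrivSqZeroExt.snd (map_logT (mapDual (TrivSqZeroExt.fstHom 𝕜 (Tau 𝔸) (Tau 𝔸)))
    (PhiGAt 𝕜 ρ (GfL2 ω₁ ω₂ E) (GbL2 ω₁ ω₂ Eb) L μ y * invT (PhiGAt 𝕜 ρ (GfL2 0 0 E) (GbL2 0 0 Eb) L μ y)))
  simp only [map_mul, map_invT, map_PhiGAt, h2, h2z, h2b, h2bz, snd_mapDual, TrivSqZeroExt.fstHom_apply] at k2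
  have k3 := congrArg TrivSqZeroExt.snd (map_logT (mergeDual (𝕜 := 𝕜))
    (PhiGAt 𝕜 ρ (GfL2 ω₁ ω₂ E) (GbL2 ω₁ ω₂ Eb) L μ y * invT (PhiGAt 𝕜 ρ (GfL2 0 0 E) (GbL2 0 0 Eb) L μ y)))
  simp only [map_mul, map_invT, map_PhiGAt, h3, h3z, h3b, h3bz, snd_mergeDual] at k3
  exact k3.symm.trans (congrArg₂ HAdd.hAdd k1 k2)

/-- [folklore] The rooted jet of the zero fluctuation vanishes (any background). -/
@[simp] theorem QjetLAt_zero (ρ : Fin d → ℤ) (E Eb : Form1 d (Tau 𝔸)) (L : ℕ) (μ : Fin d) (y : Fin d → ℤ) :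
    QjetLAt 𝕜 ρ (0 : Form1 d (Tau 𝔸)) E Eb L μ y = 0 := by
  have h := QjetLAt_add (𝕜 := 𝕜) ρ (0 : Form1 d (Tau 𝔸)) 0 E Eb L μ y
  rw [add_zero] at h
  exact left_eq_add.mp h

/-- [folklore] The rooted jet is odd in the fluctuation. -/
theorem QjetLAt_neg (ρ : Fin d → ℤ) (ω E Eb : Form1 d (Tau 𝔸)) (L : ℕ) (μ : Fin d) (y : Fin d → ℤ) :
    QjetLAt 𝕜 ρ (-ω) E Eb L μ y = -QjetLAt 𝕜 ρ ω E Eb L μ y := by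
  have h := QjetLAt_add (𝕜 := 𝕜) ρ (-ω) ω E Eb L μ y
  rw [neg_add_cancel, QjetLAt_zero] at h
  exact (neg_eq_of_add_eq_zero_left h.symm).symm

/-- [folklore] The rooted jet is subtractive in the fluctuation. -/
theorem QjetLAt_sub (ρ : Fin d → ℤ) (ω₁ ω₂ E Eb : Form1 d (Tau 𝔸)) (L : ℕ) (μ : Fin d) (y : Fin d → ℤ) :
    QjetLAt 𝕜 ρ (ω₁ - ω₂) E Eb L μ y = QjetLAt 𝕜 ρ ω₁ E Eb L μ y - QjetLAt 𝕜 ρ ω₂ E Eb L μ y := by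
  rw [sub_eq_add_neg, QjetLAt_add, QjetLAt_neg, ← sub_eq_add_neg]

/-- [folklore] The rooted jet of a finite sum of fluctuations. -/
theorem QjetLAt_sum {ι' : Type*} (s : Finset ι') (ω : ι' → Form1 d (Tau 𝔸)) (ρ : Fin d → ℤ) (E Eb : Form1 d (Tau 𝔸))
    (L : ℕ) (μ : Fin d) (y : Fin d → ℤ) :
    QjetLAt 𝕜 ρ (∑ i ∈ s, ω i) E Eb L μ y = ∑ i ∈ s, QjetLAt 𝕜 ρ (ω i) E Eb L μ y := by
  classical
  induction s using Finset.induction_on with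
  | empty => simp
  | insert i s hi ih => rw [Finset.sum_insert hi, Finset.sum_insert hi, QjetLAt_add, ih]

/-! ## §3 Node 12b's chart: `QjetAt` and `T2At` -/

/-- [folklore] ADDITIVITY of node 12b's rooted jet `QjetAt ρ` in the fluctuation. -/
theorem QjetAt_add_ω (ρ : Fin d → ℤ) (ω₁ ω₂ : Form1 d (Tau 𝔸)) (B B' : Form1 d 𝔸) (L : ℕ) (μ : Fin d) (y : Fin d → ℤ) :
    QjetAt 𝕜 ρ (ω₁ + ω₂) B B' L μ y = QjetAt 𝕜 ρ ω₁ B B' L μ y + QjetAt 𝕜 ρ ω₂ B B' L μ y := by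
  simp only [QjetAt_eq_QjetLAt, QjetLAt_add]

/-- [folklore] The rooted jet is odd in the fluctuation. -/
theorem QjetAt_neg_ω (ρ : Fin d → ℤ) (ω : Form1 d (Tau 𝔸)) (B B' : Form1 d 𝔸) (L : ℕ) (μ : Fin d) (y : Fin d → ℤ) :
    QjetAt 𝕜 ρ (-ω) B B' L μ y = -QjetAt 𝕜 ρ ω B B' L μ y := by
  simp only [QjetAt_eq_QjetLAt, QjetLAt_neg]

/-- [folklore] … subtractive. -/
theorem QjetAt_sub_ω (ρ : Fin d → ℤ) (ω₁ ω₂ : Form1 d (Tau 𝔸)) (B B' : Form1 d 𝔸) (L : ℕ) (μ : Fin d) (y : Fin d → ℤ) :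
    QjetAt 𝕜 ρ (ω₁ - ω₂) B B' L μ y = QjetAt 𝕜 ρ ω₁ B B' L μ y - QjetAt 𝕜 ρ ω₂ B B' L μ y := by
  simp only [QjetAt_eq_QjetLAt, QjetLAt_sub]

/-- [folklore] HOMOGENEITY of node 12b's rooted jet under central elements of `Tau 𝔸`. -/
theorem QjetAt_mul_central (s : Tau 𝔸) (hs : ∀ t, s * t = t * s) (ρ : Fin d → ℤ) (ω : Form1 d (Tau 𝔸))
    (B B' : Form1 d 𝔸) (L : ℕ) (μ : Fin d) (y : Fin d → ℤ) :
    QjetAt 𝕜 ρ (fun κ x => s * ω κ x) B B' L μ y = s * QjetAt 𝕜 ρ ω B B' L μ y := by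
  simp only [QjetAt_eq_QjetLAt, QjetLAt_mul_central s hs]

/-- [folklore] `𝕜`-homogeneity of node 12b's rooted jet. -/
theorem QjetAt_smul_ω (r : 𝕜) (ρ : Fin d → ℤ) (ω : Form1 d (Tau 𝔸)) (B B' : Form1 d 𝔸) (L : ℕ) (μ : Fin d)
    (y : Fin d → ℤ) : QjetAt 𝕜 ρ (r • ω) B B' L μ y = r • QjetAt 𝕜 ρ ω B B' L μ y := by
  simp only [QjetAt_eq_QjetLAt, QjetLAt_smul]

/-- [folklore] ADDITIVITY of the symmetrised second-order response `T2At ρ` in the fluctuation. -/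
theorem T2At_add_ω (ρ : Fin d → ℤ) (ω₁ ω₂ : Form1 d (Tau 𝔸)) (B B' : Form1 d 𝔸) (L : ℕ) (μ : Fin d) (y : Fin d → ℤ) :
    T2At 𝕜 ρ (ω₁ + ω₂) B B' L μ y = T2At 𝕜 ρ ω₁ B B' L μ y + T2At 𝕜 ρ ω₂ B B' L μ y := by
  simp only [T2At, QjetAt_add_ω, c11_add]; abel

/-- [folklore] `T2At ρ` is odd in the fluctuation. -/
theorem T2At_neg_ω (ρ : Fin d → ℤ) (ω : Form1 d (Tau 𝔸)) (B B' : Form1 d 𝔸) (L : ℕ) (μ : Fin d) (y : Fin d → ℤ) :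
    T2At 𝕜 ρ (-ω) B B' L μ y = -T2At 𝕜 ρ ω B B' L μ y := by
  simp only [T2At, QjetAt_neg_ω, c11_neg]; abel

/-- [folklore] `𝕜`-homogeneity of `T2At ρ` in the fluctuation. -/
theorem T2At_smul_ω (r : 𝕜) (ρ : Fin d → ℤ) (ω : Form1 d (Tau 𝔸)) (B B' : Form1 d 𝔸) (L : ℕ) (μ : Fin d)
    (y : Fin d → ℤ) : T2At 𝕜 ρ (r • ω) B B' L μ y = r • T2At 𝕜 ρ ω B B' L μ y := by
  simp only [T2At, QjetAt_smul_ω, c11_smul, smul_add]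

end Summit.QuantumFields.BalabanUV.Beta.RootedJetLinear
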